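import Summits.BirchSwinnertonDyer.Rank1Residual.WAll.TargetCMTwoRamifiedThetaCriterion
import Summits.BirchSwinnertonDyer.BirchSwinnertonDyer.Theorems.PrintCf2RamifiedOffTYZThetaFourLeaf
import Summits.BirchSwinnertonDyer.Rank1Residual.P2.CongruentNumberThetaCriterion
import Summits.BirchSwinnertonDyer.Rank1Residual.P2.CongruentNumberPairsAtTwoEvenDoorDescent
import Summits.BirchSwinnertonDyer.Rank1Residual.P2.CongruentNumberPairsAtTwoUPlusSix
import Summits.BirchSwinnertonDyer.Rank1Residual.P2.CongruentNumberPairsAtTwoRankOneGenus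
import HarnessLib

/-!
# Route `PrintCf2`, crux stmt-BirchSwinnertonDyer-20509 `RamifiedOffTYZOfFacts` — THE UNIFORM Θ-CRITERION CLASS
# («Tian's induction on the number of prime factors», route-B form, every `k`) CARVED OUT OF THE ISOGENY-CLASS RESIDUAL AND
# CLOSED BY NAME beyond the bundle, from EXACTLY the antecedent of aside 21185; the residual stub re-cut (cell
# `bsd-print-cf2`, seat p1 = lead; skeleton v5)

HONEST FRAMING (cell `bsd-print-cf2`; route `PrintCf2`; crux 20509 = `𝔅_ram → WAllCornerFTwoRamifiedOffTYZProved`, OPEN):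
the W-ALL file `WAll/TargetCMTwoRamifiedThetaCriterion.lean` (this seat) names the class of cell `bsd-monsky`'s UNIFORM
Θ-criterion (`P2.ThetaDescent.exists_odd_isScriptL_of_thetaCert_of_cmPointGaloisData`, prover-B): `n = 2p₁⋯p_k ≡ 6 (mod 8)`,
`s(n) = 1`, `θ`-controlled, with a Θ-certificate `s` written on TYZ Thm 1.1's genus sums `Σ₁(e/d₀)` (a DECIDABLE condition
on `n`). This file proves:

* §1 `intCast_eq_genusSum₁_of_isScriptL` — the bridge: for square-free `m ≡ 1 (mod 8)` and ANY sign choice `L` with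
  `L² = 𝓛(m)²`, `L ≡ Σ₁(m) (mod 2)` (TYZ Thm 1.1 `h11` at the genus-field family `GenusField`, and `L = ±L′`); and
  `mod_eight_eq_one_of_mem_recursionIndex_six` — a `6`-block `d₀` of a `6`-block `e` in TYZ's recursion has cofactor
  `e/d₀ ≡ 1 (mod 8)`.
* §2 `rankOne_sha_bsdp_two_of_thetaCriterion` — `ord_{s=1} L(E_n, s) = 1 ∧ rank 1 ∧ Ш(E_n)[2^∞] = 0 ∧ BSD(E_n, 2)` on the
  WHOLE Θ-criterion class, relative to {`tyz_cmPointGaloisData`, `thm11_parity_of_scriptL`, GZK} ONLY: the decidable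
  certificate is transported to every printed data `D` by §1 (`D.scriptL (e/d₀)` has the parity of `Σ₁(e/d₀)`), the
  uniform criterion gives an ODD `𝓛(n)`, and the GZK-only uniform even door
  (`P2.rankOne_sha_bsdp_two_iff_congruentNumberCurve_two_mul_prod_descent`, `s(n) = 1`, rank-one datum `x = 2^{2k−2}𝓛(n)²`)
  gives the four conclusions.
* §3 CLOSER BY NAME `wAllCornerFTwoRamifiedThetaCriterion_of_facts (hCM) (h11) (hGZK) (hCAS) (hMOD)` (models fact-free,
  isogenies by Cassels transport) and the Plus-shaped term
  `thetaCriterion_of_bundlePlus : (𝔅_ram ∧ thm11_parity_of_scriptL ∧ tyz_cmPointGaloisData) → WAllCornerFTwoRamifiedThetaCriterion`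
  — EXACTLY the antecedent of the CLOSED aside 21185 `RamifiedThetaOfFactsPlus`.
* §4 the lead's bookkeeping: the v4 residual stub (`𝔅_ram → WAllCornerFTwoRamifiedOffBookedIsogenyOffThetaFour`) is CUT into
  «𝔅_ram ⟹ Θ-criterion leaf» (closable beyond the bundle) and «𝔅_ram ⟹ WAllCornerFTwoRamifiedOffBookedIsogenyOffThetaCriterion»
  (OPEN, no print); the composition `offTYZProved_of_bundle_of_uPlus_of_theta_of_shuZhai_of_thetaFour_of_thetaCriterion_of_off`.

TURNKEY for -plan (aside, leaf form, same antecedent as 21185): `RamifiedThetaCriterionOfFactsPlus :=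
(<𝔅_ram VERBATIM> ∧ thm11_parity_of_scriptL ∧ tyz_cmPointGaloisData) → Summit.BirchSwinnertonDyer.WAllCornerFTwoRamifiedThetaCriterion`,
closed by `fun h ↦ Summit.BirchSwinnertonDyer.PrintCf2.thetaCriterion_of_bundlePlus h`. Booking currency LITERAL-by-name(hCM)
(as 21185). beyond-print theorem: YES (the class theorem of the induction itself, uniform in `k`; Monsky 1990 Rem. (3) is
`k = 2`, TYZ Thm 1.2 is silent on part of the class — census: all 1373 booked even theta/tower/𝒮⁻/four-prime classes
`n ≤ 3·10⁴` plus 240 more satisfy the criterion). No route file imported. Nothing asserted.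
[cite: TianYuanZhang2017, Thm. 1.1 (p0002 L90–L99), §1 (1.1), §3.1, Thm. 3.5, Thm. 3.6] [cite: HeathBrown1994SelmerCongruentII,
Appendix (Monsky), typescript p. 41 L20–L36] [cite: Monsky1990MockHeegner, p. 67 Remark (3)] [cite: Miller2011LMS, Def. 1.1
(arXiv:1010.2431 p. 3)] [cite: MilneADT2006, Thm. I.7.3]
-/

noncomputable section

open scoped Classical

open WeierstrassCurve Summit.BirchSwinnertonDyer Summit.BirchSwinnertonDyer.Rank1Residual
  Literature.NumberTheory.EllipticCurves Literature.NumberTheory.EllipticCurves.Rank1Residual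
  Literature.NumberTheory.EllipticCurves.HeathBrown1994
  Literature.NumberTheory.EllipticCurves.TianYuanZhang2017

set_option autoImplicit false

namespace Summit.BirchSwinnertonDyer.PrintCf2

/-! ## §1 The bridge: TYZ Thm 1.1 fixes the parity of every sign choice of `𝓛(m)`, `m ≡ 1 (mod 8)` -/

/-- **`L ≡ Σ₁(m) (mod 2)` for EVERY `L` with `L² = 𝓛(m)²`**, `m ≡ 1 (mod 8)` square-free: TYZ Thm 1.1 at the genus-field family
`GenusField` gives one such `L′` with the parity of `Σ₁(m)`, and `L = ±L′`. [cite: TianYuanZhang2017, Thm. 1.1 (p0002 L90–L99)] -/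
theorem intCast_eq_genusSum₁_of_isScriptL (h11 : thm11_parity_of_scriptL) {m : ℕ} (hsq : Squarefree m) (hm : m % 8 = 1)
    {L : ℤ} (hL : IsScriptL m L) :
    (L : ZMod 2) = (genusSum₁ m (fun d => genusClassNumber (GenusField d)) : ZMod 2) := by
  obtain ⟨L', hL', hpar⟩ := h11 m hsq (Or.inl hm) GenusField (isGenusFieldFamily_genusField _)
  have hsq' : L ^ 2 = L' ^ 2 := by
    have h : ((L : ℂ)) ^ 2 = ((L' : ℂ)) ^ 2 := by rw [hL, hL']
    exact_mod_cast h
  rcases sq_eq_sq_iff_eq_or_eq_neg.mp hsq' with h | h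
  · rw [h]; exact hpar
  · rw [h, Int.cast_neg, hpar, ZMod.neg_eq_self_mod_two]

/-- In TYZ's recursion a `6`-block `d₀` of a `6`-block `e` has cofactor `e/d₀ ≡ 1 (mod 8)` (the index set allows
`e/d₀ ≡ 1, 2, 3`; `6·2 ≡ 4` and `6·3 ≡ 2 (mod 8)`). [cite: TianYuanZhang2017, §3.1 (p0011 L67–L70)] -/
theorem mod_eight_eq_one_of_mem_recursionIndex_six {e d₀ : ℕ} (he : e % 8 = 6)
    (hd₀ : d₀ ∈ (recursionIndex e).filter (fun d₀ => d₀ % 8 = 6)) : d₀ ∣ e ∧ 1 < e / d₀ ∧ (e / d₀) % 8 = 1 := by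
  rw [Finset.mem_filter, recursionIndex, Finset.mem_filter, Nat.mem_divisors] at hd₀
  obtain ⟨⟨⟨hdvd, -⟩, -, h123, hlt⟩, h6⟩ := hd₀
  refine ⟨hdvd, hlt, ?_⟩
  have hmul : d₀ * (e / d₀) = e := Nat.mul_div_cancel' hdvd
  have hmod : e % 8 = (d₀ % 8) * ((e / d₀) % 8) % 8 :=
    calc e % 8 = d₀ * (e / d₀) % 8 := by rw [hmul]
      _ = (d₀ % 8) * ((e / d₀) % 8) % 8 := Nat.mul_mod _ _ _
  rw [he, h6] at hmod
  rcases h123 with h | h | h <;> rw [h] at hmod <;> omega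

/-! ## §2 The class theorem of the induction: the four conclusions on the whole Θ-criterion class -/

/-- **`ord_{s=1} L(E_n, s) = 1 ∧ rank E_n(ℚ) = 1 ∧ Ш(E_n)[2^∞] = 0 ∧ BSD(E_n, 2)` ON THE UNIFORM Θ-CRITERION CLASS** — for
`n = 2p₁⋯p_k ≡ 6 (mod 8)` (distinct primes) with Monsky's `s(n) = 1`, `θ`-controlled, and a Θ-certificate `s` on the
`6`-blocks written with TYZ Thm 1.1's `Σ₁` — relative to {`tyz_cmPointGaloisData`, `thm11_parity_of_scriptL`, GZK} ONLY.
The certificate is transported to every printed data `D` by §1; prover-B's uniform criterion gives `𝓛(n)` odd; the GZK-only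
even door gives the rest (Monsky's upper bound on `Sel₂` being a tree theorem). Beyond print.
[cite: TianYuanZhang2017, Thm. 1.1, §1 (1.1), Thm. 3.5, Thm. 3.6] [cite: HeathBrown1994SelmerCongruentII, Appendix (Monsky),
typescript p. 41 L20–L36] [cite: Miller2011LMS, Def. 1.1 (arXiv:1010.2431 p. 3)] -/
theorem rankOne_sha_bsdp_two_of_thetaCriterion (hCM : tyz_cmPointGaloisData) (h11 : thm11_parity_of_scriptL)
    (hGZK : rank_eq_analyticRank_of_analyticRank_le_one) {k : ℕ} {p : Fin k → ℕ} {n : ℕ} (hp : ∀ i, (p i).Prime)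
    (hinj : Function.Injective p) (hn : 2 * ∏ i, p i = n) (h6 : n % 8 = 6) (hs : monskySelmerRankEven p = 1)
    (hctrl : ∀ d₀ ∈ n.divisors, d₀ % 8 = 7 → (n / d₀) % 8 = 2 → ∀ d' ∈ d₀.divisors, d' % 8 = 5 →
      ∀ q ∈ d'.primeFactors, q % 4 = 1)
    (hcert : ∃ s : ℕ → ZMod 2,
      (∀ e ∈ n.divisors, e % 8 = 6 → (n / e) % 8 = 1 →
        s e = (genusClassNumber (GenusField e) : ZMod 2) +
          ∑ d₀ ∈ (recursionIndex e).filter (fun d₀ => d₀ % 8 = 6),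
            (genusSum₁ (e / d₀) (fun d => genusClassNumber (GenusField d)) : ZMod 2) * s d₀) ∧
      s n = 1) :
    (congruentNumberCurve n).analyticRank = 1 ∧ (congruentNumberCurve n).mordellWeilRank = 1 ∧
      AddCommGroup.primaryComponent (congruentNumberCurve n).sha 2 = ⊥ ∧ BSDp (congruentNumberCurve n) 2 := by
  have hodd : ∀ i, Odd (p i) := odd_of_two_mul_prod_eq_of_mod_eight hp hn h6
  have hsq : Squarefree n := hn ▸ squarefree_two_mul_prod_of_injective p hp hodd hinj
  have hn0 : n ≠ 0 := hsq.ne_zero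
  haveI := isElliptic_congruentNumberCurve hn0
  -- the decidable certificate is a Θ-certificate for every printed data `D`
  have hΘ : ∀ D : GenusPointData n, D.Printed → D.CMPointGaloisPrinted → ∃ s : ℕ → ZMod 2,
      (∀ e ∈ n.divisors, e % 8 = 6 → (n / e) % 8 = 1 →
        s e = (gK e : ZMod 2) +
          ∑ d₀ ∈ (recursionIndex e).filter (fun d₀ => d₀ % 8 = 6), (D.scriptL (e / d₀) : ZMod 2) * s d₀) ∧
      s n = 1 := by
    intro D hD _
    obtain ⟨s, hs', hsn⟩ := hcert
    refine ⟨s, fun e he h6e h1 => ?_, hsn⟩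
    rw [hs' e he h6e h1]
    have hen : e ∣ n := (Nat.mem_divisors.mp he).1
    congr 1
    refine Finset.sum_congr rfl fun d₀ hd₀ => ?_
    obtain ⟨hdvd, hlt, hm1⟩ := mod_eight_eq_one_of_mem_recursionIndex_six h6e hd₀
    have hmn : e / d₀ ∣ n := dvd_trans (Nat.div_dvd_of_dvd hdvd) hen
    have hmem : e / d₀ ∈ n.divisors := Nat.mem_divisors.mpr ⟨hmn, hn0⟩
    have hsqm : Squarefree (e / d₀) := hsq.squarefree_of_dvd hmn
    rw [← intCast_eq_genusSum₁_of_isScriptL h11 hsqm hm1 (hD.1 _ hmem hlt)]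
  obtain ⟨L, hLodd, hL⟩ :=
    P2.ThetaDescent.exists_odd_isScriptL_of_thetaCert_of_cmPointGaloisData hCM hGZK hsq h6 hctrl hΘ
  -- the rank-one datum `x = 2^{2k−2} L²`
  have hL0' : L ≠ 0 := fun h => by simp [h] at hLodd
  have hL0 : (L : ℚ) ≠ 0 := by exact_mod_cast hL0'
  have hr1 := analyticRank_congruentNumberCurve_eq_one_of_isScriptL hsq (Or.inr (Or.inl h6)) hL hL0'
  have he : twoExponent n = 2 * (k : ℤ) - 2 := by rw [← hn]; exact P2.twoExponent_two_mul_prod_eq p hp hodd hinj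
  have hx0 : (2 : ℚ) ^ twoExponent n * (L : ℚ) ^ 2 ≠ 0 :=
    mul_ne_zero (zpow_ne_zero _ two_ne_zero) (pow_ne_zero _ hL0)
  have hx : deriv (congruentNumberCurve n).entireLFunction 1 =
      (((2 : ℚ) ^ twoExponent n * (L : ℚ) ^ 2 : ℚ) : ℂ) * ((congruentNumberCurve n).realPeriodRat : ℂ) *
        ((congruentNumberCurve n).regulator : ℂ) := by
    rw [← (leadingLCoeff_eq_deriv_of_analyticRank_eq_one hr1).1,
      leadingLCoeff_congruentNumberCurve_eq_of_isScriptL (Nat.pos_of_ne_zero hn0) hr1 hL]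
    push_cast
    ring
  obtain ⟨hr1', hrk, hsha, hiff⟩ :=
    P2.rankOne_sha_bsdp_two_iff_congruentNumberCurve_two_mul_prod_descent p hGZK hp hinj hn h6 hs hx0 hx
  exact ⟨hr1', hrk, hsha, hiff.mpr (by rw [P2.padicValRat_two_zpow_mul_sq hLodd, he])⟩

/-! ## §3 CLOSER BY NAME of the leaf `WAllCornerFTwoRamifiedThetaCriterion` (beyond the bundle) -/

/-- **CLOSER of the Θ-criterion leaf**, modulo the TYZ §3 CM-point display (`hCM`), TYZ Thm 1.1 as printed (`h11`), GZK
(`hGZK`), Cassels (`hCAS`) and modularity (`hMOD`): a member `W₀` is a model of `E_n` in the class (§2, moved to the model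
fact-free); `W ∼ W₀` by Cassels transport in analytic rank one. The leaf's hypotheses `HasCM`, `CMRamified` are not used (they
HOLD, `hasCM_and_cmRamified_two_of_congruentThetaCriterionIsogenyClass`). [cite: TianYuanZhang2017, Thm. 1.1, Thm. 3.5, Thm. 3.6]
[cite: MilneADT2006, Thm. I.7.3] [cite: Miller2011LMS, Def. 1.1 (arXiv:1010.2431 p. 3)] -/
theorem wAllCornerFTwoRamifiedThetaCriterion_of_facts (hCM : tyz_cmPointGaloisData) (h11 : thm11_parity_of_scriptL)
    (hGZK : rank_eq_analyticRank_of_analyticRank_le_one) (hCAS : bsdRHS_eq_of_isIsogenous)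
    (hMOD : hasEntireLFunction_rat) : WAllCornerFTwoRamifiedThetaCriterion := by
  intro W _ _ _ hr _ hI
  obtain ⟨W₀, _, _, hiso, hmem⟩ := hI
  obtain ⟨k, p, n, hp, hinj, hn, h6, hs, hctrl, hcert, C, hC⟩ := hmem
  have h := rankOne_sha_bsdp_two_of_thetaCriterion hCM h11 hGZK hp hinj hn h6 hs hctrl hcert
  have hodd : ∀ i, Odd (p i) := odd_of_two_mul_prod_eq_of_mod_eight hp hn h6
  have hsq : Squarefree n := hn ▸ squarefree_two_mul_prod_of_injective p hp hodd hinj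
  have h₀ : BSDp W₀ 2 := (P2.CornerFTwo.CongruentNumber.analyticRank_eq_one_and_bsdp_two_of_smul hsq ⟨h.1, h.2.2.2⟩ hC).2
  exact bsdp_two_of_isIsogenous_of_facts hCAS hGZK hMOD hiso hr h₀

/-- **The Θ-criterion leaf from the bundle PLUS the two displayed facts** — the term of the `…OfFactsPlus` aside the planner
files (antecedent `𝔅_ram ∧ thm11_parity_of_scriptL ∧ tyz_cmPointGaloisData`, VERBATIM that of aside 21185; uses conjuncts
1–3 of `𝔅_ram` and the two extras). [cite: TianYuanZhang2017, Thm. 1.1, Thm. 3.5, Thm. 3.6] [cite: Miller2011LMS, Def. 1.1] -/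
theorem thetaCriterion_of_bundlePlus
    (h : (Literature.NumberTheory.EllipticCurves.rank_eq_analyticRank_of_analyticRank_le_one ∧ WeierstrassCurve.hasEntireLFunction_rat ∧ WeierstrassCurve.bsdRHS_eq_of_isIsogenous ∧ Literature.NumberTheory.EllipticCurves.bsdTriple_of_hasCM_of_L_one_ne_zero ∧ Literature.NumberTheory.EllipticCurves.TianYuanZhang2017.thm12_parity_of_scriptL' ∧ Literature.NumberTheory.EllipticCurves.Tian2014.thm13_rank_one_and_sha_odd ∧ Literature.NumberTheory.QuadraticFields.RedeiReichardt.redeiReichardt_fourTwoCard_classGroup ∧ Literature.NumberTheory.EllipticCurves.LiLiuTian2024.thm12_bsd_congruentNumberCurve ∧ Literature.NumberTheory.EllipticCurves.Monsky1990.cor515_rank_eq_one_and_card_selmerGroup_two ∧ Literature.NumberTheory.EllipticCurves.HeathBrown1994.monsky_card_selmerGroup_two_even ∧ Literature.NumberTheory.EllipticCurves.Tian2014.tian2014_system_sMinus_genus) ∧ Literature.NumberTheory.EllipticCurves.TianYuanZhang2017.thm11_parity_of_scriptL ∧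
      Literature.NumberTheory.EllipticCurves.TianYuanZhang2017.tyz_cmPointGaloisData) :
    Summit.BirchSwinnertonDyer.WAllCornerFTwoRamifiedThetaCriterion :=
  wAllCornerFTwoRamifiedThetaCriterion_of_facts h.2.2 h.2.1 h.1.1 h.1.2.2.1 h.1.2.1

/-! ## §4 Skeleton v5 of crux 20509: the v4 residual stub re-cut, and the composition -/

/-- **The v4 residual stub `stub_offTYZ_residual` (𝔅_ram ⟹ `WAllCornerFTwoRamifiedOffBookedIsogenyOffThetaFour`) is CUT**: it
follows from «𝔅_ram ⟹ Θ-criterion leaf» (closable beyond the bundle, `thetaCriterion_of_bundlePlus`) and «𝔅_ram ⟹ the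
residual off the Θ-criterion class» (OPEN, no print). [folklore] -/
theorem stub_offTYZ_residual_of_thetaCriterion_of_off
    (hT : (Literature.NumberTheory.EllipticCurves.rank_eq_analyticRank_of_analyticRank_le_one ∧ WeierstrassCurve.hasEntireLFunction_rat ∧ WeierstrassCurve.bsdRHS_eq_of_isIsogenous ∧ Literature.NumberTheory.EllipticCurves.bsdTriple_of_hasCM_of_L_one_ne_zero ∧ Literature.NumberTheory.EllipticCurves.TianYuanZhang2017.thm12_parity_of_scriptL' ∧ Literature.NumberTheory.EllipticCurves.Tian2014.thm13_rank_one_and_sha_odd ∧ Literature.NumberTheory.QuadraticFields.RedeiReichardt.redeiReichardt_fourTwoCard_classGroup ∧ Literature.NumberTheory.EllipticCurves.LiLiuTian2024.thm12_bsd_congruentNumberCurve ∧ Literature.NumberTheory.EllipticCurves.Monsky1990.cor515_rank_eq_one_and_card_selmerGroup_two ∧ Literature.NumberTheory.EllipticCurves.HeathBrown1994.monsky_card_selmerGroup_two_even ∧ Literature.NumberTheory.EllipticCurves.Tian2014.tian2014_system_sMinus_genus) → Summit.BirchSwinnertonDyer.WAllCornerFTwoRamifiedThetaCriterion)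
    (hO : (Literature.NumberTheory.EllipticCurves.rank_eq_analyticRank_of_analyticRank_le_one ∧ WeierstrassCurve.hasEntireLFunction_rat ∧ WeierstrassCurve.bsdRHS_eq_of_isIsogenous ∧ Literature.NumberTheory.EllipticCurves.bsdTriple_of_hasCM_of_L_one_ne_zero ∧ Literature.NumberTheory.EllipticCurves.TianYuanZhang2017.thm12_parity_of_scriptL' ∧ Literature.NumberTheory.EllipticCurves.Tian2014.thm13_rank_one_and_sha_odd ∧ Literature.NumberTheory.QuadraticFields.RedeiReichardt.redeiReichardt_fourTwoCard_classGroup ∧ Literature.NumberTheory.EllipticCurves.LiLiuTian2024.thm12_bsd_congruentNumberCurve ∧ Literature.NumberTheory.EllipticCurves.Monsky1990.cor515_rank_eq_one_and_card_selmerGroup_two ∧ Literature.NumberTheory.EllipticCurves.HeathBrown1994.monsky_card_selmerGroup_two_even ∧ Literature.NumberTheory.EllipticCurves.Tian2014.tian2014_system_sMinus_genus) → Summit.BirchSwinnertonDyer.WAllCornerFTwoRamifiedOffBookedIsogenyOffThetaCriterion) :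
    (Literature.NumberTheory.EllipticCurves.rank_eq_analyticRank_of_analyticRank_le_one ∧ WeierstrassCurve.hasEntireLFunction_rat ∧ WeierstrassCurve.bsdRHS_eq_of_isIsogenous ∧ Literature.NumberTheory.EllipticCurves.bsdTriple_of_hasCM_of_L_one_ne_zero ∧ Literature.NumberTheory.EllipticCurves.TianYuanZhang2017.thm12_parity_of_scriptL' ∧ Literature.NumberTheory.EllipticCurves.Tian2014.thm13_rank_one_and_sha_odd ∧ Literature.NumberTheory.QuadraticFields.RedeiReichardt.redeiReichardt_fourTwoCard_classGroup ∧ Literature.NumberTheory.EllipticCurves.LiLiuTian2024.thm12_bsd_congruentNumberCurve ∧ Literature.NumberTheory.EllipticCurves.Monsky1990.cor515_rank_eq_one_and_card_selmerGroup_two ∧ Literature.NumberTheory.EllipticCurves.HeathBrown1994.monsky_card_selmerGroup_two_even ∧ Literature.NumberTheory.EllipticCurves.Tian2014.tian2014_system_sMinus_genus) → Summit.BirchSwinnertonDyer.WAllCornerFTwoRamifiedOffBookedIsogenyOffThetaFour :=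
  fun hB ↦ wAllCornerFTwoRamifiedOffBookedIsogenyOffThetaFour_of_thetaCriterion_of_off (hT hB) (hO hB)

/-- **Crux 20509's conclusion from the bundle, the five beyond-bundle leaves and the residual off them** — the composition
`RamifiedOffTYZOfFacts_of` of the lead's skeleton v5: U⁺ (`hU`, aside 20471), theta (`hT`, 21185), Shu–Zhai `256c1` (`hZ`,
21183), four-prime theta (`hT4`), Θ-criterion (`hTC`), residual (`hO`, OPEN). [folklore] -/
theorem offTYZProved_of_bundle_of_uPlus_of_theta_of_shuZhai_of_thetaFour_of_thetaCriterion_of_off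
    (hB : (Literature.NumberTheory.EllipticCurves.rank_eq_analyticRank_of_analyticRank_le_one ∧ WeierstrassCurve.hasEntireLFunction_rat ∧ WeierstrassCurve.bsdRHS_eq_of_isIsogenous ∧ Literature.NumberTheory.EllipticCurves.bsdTriple_of_hasCM_of_L_one_ne_zero ∧ Literature.NumberTheory.EllipticCurves.TianYuanZhang2017.thm12_parity_of_scriptL' ∧ Literature.NumberTheory.EllipticCurves.Tian2014.thm13_rank_one_and_sha_odd ∧ Literature.NumberTheory.QuadraticFields.RedeiReichardt.redeiReichardt_fourTwoCard_classGroup ∧ Literature.NumberTheory.EllipticCurves.LiLiuTian2024.thm12_bsd_congruentNumberCurve ∧ Literature.NumberTheory.EllipticCurves.Monsky1990.cor515_rank_eq_one_and_card_selmerGroup_two ∧ Literature.NumberTheory.EllipticCurves.HeathBrown1994.monsky_card_selmerGroup_two_even ∧ Literature.NumberTheory.EllipticCurves.Tian2014.tian2014_system_sMinus_genus))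
    (hU : WAllCornerFTwoRamifiedTYZUPlus) (hT : WAllCornerFTwoRamifiedTheta)
    (hZ : WAllCornerFTwoRamifiedShuZhaiTwoFiftySix) (hT4 : WAllCornerFTwoRamifiedThetaFour)
    (hTC : WAllCornerFTwoRamifiedThetaCriterion) (hO : WAllCornerFTwoRamifiedOffBookedIsogenyOffThetaCriterion) :
    WAllCornerFTwoRamifiedOffTYZProved :=
  offTYZProved_of_bundle_of_uPlus_of_theta_of_shuZhai_of_thetaFour_of_off hB hU hT hZ hT4
    (wAllCornerFTwoRamifiedOffBookedIsogenyOffThetaFour_of_thetaCriterion_of_off hTC hO)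

end Summit.BirchSwinnertonDyer.PrintCf2

end
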